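import Summits.ValiantsHypothesis.ValiantsHypothesis.Theorems.TwoAdicLadderTwoIntegralNormalisationPrecisionUniform

/-!
# TwoAdicLadder — crux `TwoIntegralNormalisation` (stmt-ValiantsHypothesis-5947), line `birth`:
# the LOGICAL POSITION of the exact-division statement

With `TwoIntegralNormalisation ↔ DivElimGlobal` in the tree (`…PrecisionUniform.lean`), the
refuter's route-review observation "`TwoIntegralNormalisation ↔ (IsPComputable (per/ℂ) →
¬ PrecisionLadder)`" (item note b500b1b3, evidence `TwoAdicLadderAssemblyProof.lean`, not landed
under `Theorems`) gives the exact-division statement its sharpest reading: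

* `twoIntegralNormalisation_iff_not_precisionLadder` — the crux says precisely: **if the permanent
  is p-computable over `ℂ` then the `2`-adic precision ladder collapses** (one exponent serves
  every precision, eventually in `n`);
* `divElimGlobal_iff_collapse` — hence **`DivElimGlobal ↔ (VP_ℂ = VNP_ℂ → ¬ PrecisionLadder)`**:
  exact division of the scaled permanents by powers of `2` at polynomial cost is EQUIVALENT to the
  statement that a collapse of Valiant's classes over `ℂ` forces uniformly cheap circuits for the
  permanent over finite `2`-adic chain rings of every precision;
* `divElimGlobal_iff_ladder_imp_VH` — equivalently `DivElimGlobal ↔ (PrecisionLadder → VP ≠ VNP)`.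

Honest framing: propositional bookkeeping around an OPEN statement; nothing here is progress on
VP ≠ VNP.
-/

noncomputable section

open MvPolynomial

-- the summit and the problem share the name `ValiantsHypothesis` (D-0017 single-conjunct layout)
set_option linter.dupNamespace false

namespace Summit.ValiantsHypothesis.ValiantsHypothesis.Theorems.TwoAdicLadder.TwoIntegralNormalisation

open Summit.ValiantsHypothesis.ValiantsHypothesis.Theses.TwoAdicLadder
open Summit.ValiantsHypothesis.ValiantsHypothesis.Theorems.TwoAdicLadder
open NumberField Literature.Computability.AlgebraicComplexity Filter

/-- **The crux says: `per` p-computable over `ℂ` ⇒ the precision ladder collapses.**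
`TwoIntegralNormalisation ↔ (IsPComputable (per/ℂ) → ¬ PrecisionLadder)`: the conclusion of the
crux is literally the negation of `PrecisionLadder` (push the negation through `∀ c ∃ᶠ n ∃ k ∀ R`).
(Refuter route-review b500b1b3, now kernel-checked under `Theorems`.) [folklore] -/
theorem twoIntegralNormalisation_iff_not_precisionLadder :
    TwoIntegralNormalisation ↔
      (IsPComputable (fun n => perPoly (Fin n) ℂ) → ¬ PrecisionLadder) := by
  unfold TwoIntegralNormalisation PrecisionLadder
  refine imp_congr_right fun _ => ?_
  rw [not_forall]
  refine exists_congr fun a => ?_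
  rw [Filter.not_frequently]
  refine Filter.eventually_congr (Filter.Eventually.of_forall fun n => ?_)
  simp only [not_exists, not_forall, not_lt, exists_prop]

/-- **`DivElimGlobal ↔ (VP_ℂ = VNP_ℂ → ¬ PrecisionLadder)`**: exact division of the scaled
permanents by powers of `2` over `2`-integral number rings at polynomial cost (global form) holds
iff a collapse of Valiant's classes over `ℂ` forces the collapse of the `2`-adic precision ladder.
(`twoIntegralNormalisation_iff_divElimGlobal` + `twoIntegralNormalisation_iff_not_precisionLadder`
+ `isPComputable_perPoly_complex_iff`.) [folklore] -/
theorem divElimGlobal_iff_collapse :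
    ((∃ a : ℕ, ∀ n : ℕ, ∃ (K : Type) (_ : Field K) (_ : NumberField K)
        (P : Ideal (𝓞 K)) (_ : P.IsPrime), (2 : 𝓞 K) ∈ P ∧ ∃ M : ℕ,
        complexity (C ((2 : Localization.AtPrime P) ^ M) *
          perPoly (Fin n) (Localization.AtPrime P)) ≤ n ^ a + a) →
      ∃ b : ℕ, ∀ᶠ n in Filter.atTop, ∃ (K' : Type) (_ : Field K') (_ : NumberField K')
        (P : Ideal (𝓞 K')) (_ : P.IsPrime), (2 : 𝓞 K') ∈ P ∧
        complexity (perPoly (Fin n) (Localization.AtPrime P)) ≤ n ^ b) ↔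
    (VP ℂ = VNP ℂ → ¬ PrecisionLadder) := by
  rw [← twoIntegralNormalisation_iff_divElimGlobal, twoIntegralNormalisation_iff_not_precisionLadder,
    isPComputable_perPoly_complex_iff]

/-- **`DivElimGlobal ↔ (PrecisionLadder → VP ≠ VNP)`**: the exact-division statement is exactly
what turns the (VH-implied, `ladderOfVH_proof`) precision ladder into the summit. [folklore] -/
theorem divElimGlobal_iff_ladder_imp_VH :
    ((∃ a : ℕ, ∀ n : ℕ, ∃ (K : Type) (_ : Field K) (_ : NumberField K)
        (P : Ideal (𝓞 K)) (_ : P.IsPrime), (2 : 𝓞 K) ∈ P ∧ ∃ M : ℕ,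
        complexity (C ((2 : Localization.AtPrime P) ^ M) *
          perPoly (Fin n) (Localization.AtPrime P)) ≤ n ^ a + a) →
      ∃ b : ℕ, ∀ᶠ n in Filter.atTop, ∃ (K' : Type) (_ : Field K') (_ : NumberField K')
        (P : Ideal (𝓞 K')) (_ : P.IsPrime), (2 : 𝓞 K') ∈ P ∧
        complexity (perPoly (Fin n) (Localization.AtPrime P)) ≤ n ^ b) ↔
    (PrecisionLadder → _root_.ValiantsHypothesis) := by
  rw [divElimGlobal_iff_collapse]
  unfold _root_.ValiantsHypothesis Literature.PNP.ValiantHypothesis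
  tauto

end Summit.ValiantsHypothesis.ValiantsHypothesis.Theorems.TwoAdicLadder.TwoIntegralNormalisation

end
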